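import Mathlib

/-!
# Coset stabilisers in an abelian Galois group (T4-B2, step B2.7(b))

Step B2.7(b) of sub-claim B2 (route/TIER4.md) computes the reflex field `M_{T₄}` of the
non-primitive vertex `T₄` of the parity tetrahedron: after identifying `Σ = Hom(F, ℂ)` with the
Galois group `G = Gal(F/ℚ)` (abelian, `≅ ℤ/6`), the CM type `T₄` becomes a COSET `u₀·C` of the
subgroup `C = Gal(F/F₀)` of order `3`, and B2.7(b) uses three finite-group facts:

1. the stabiliser `{g : g·(u₀C) = u₀C}` of a coset of a subgroup `C` in an abelian group is `C`;
2. hence (Galois correspondence) its fixed field is the fixed field of `C`, i.e. `F₀`;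
3. in an abelian group the stabiliser of `T⁻¹` is the stabiliser of `T` (so `M_{T⁻¹} = M_T`),
   and a coset `u₀C` with `u₀² ∈ C` (e.g. `[G : C] = 2`) is inversion-stable (`T₀₁₀⁻¹ = T₀₁₀`).

This file kernel-checks 1–3.  `G` acts on its subsets by left multiplication (`Set` pointwise
action); commutativity enters only as the hypothesis `hcomm` (the printed hypothesis «F abelian
over ℚ» of Shimura §8.4 Ex. (1)), so that no instance clashes with the group structure of
`Gal(L/K)`.  Nothing here mentions CM types or varieties.
-/

namespace Summit.Ventures.HodgeRepro2.CosetStabilizer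

open Pointwise

section Group

variable {G : Type*} [Group G]

/-- General form: `g` stabilises the left coset `u • C` iff `u⁻¹ g u ∈ C`. -/
theorem mem_stabilizer_smul_coset_iff (C : Subgroup G) (u g : G) :
    g ∈ MulAction.stabilizer G (u • (C : Set G)) ↔ u⁻¹ * g * u ∈ C := by
  rw [MulAction.mem_stabilizer_iff, smul_smul, leftCoset_eq_iff, mul_inv_rev]
  constructor
  · intro h
    have h' := C.inv_mem h
    simpa [mul_assoc] using h'
  · intro h
    have h' := C.inv_mem h
    simpa [mul_assoc] using h'

/-- **B2.7(b), fact 1.** In an abelian group the stabiliser of a coset `u • C` is `C` itself. -/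
theorem stabilizer_smul_coset (hcomm : ∀ a b : G, a * b = b * a) (C : Subgroup G) (u : G) :
    MulAction.stabilizer G (u • (C : Set G)) = C := by
  ext g
  rw [mem_stabilizer_smul_coset_iff, hcomm u⁻¹ g, mul_assoc, inv_mul_cancel, mul_one]

/-- In an abelian group, `g • T⁻¹ = (g⁻¹ • T)⁻¹` for every subset `T`. -/
theorem smul_set_inv_of_comm (hcomm : ∀ a b : G, a * b = b * a) (g : G) (T : Set G) :
    g • T⁻¹ = (g⁻¹ • T)⁻¹ := by
  ext x
  rw [Set.mem_inv, Set.mem_smul_set_iff_inv_smul_mem, Set.mem_smul_set_iff_inv_smul_mem,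
    Set.mem_inv, smul_eq_mul, smul_eq_mul, inv_inv, mul_inv_rev, inv_inv, hcomm]

/-- **B2.7(b), fact 3 (first half).** In an abelian group the stabilisers of `T` and of `T⁻¹`
coincide — so the reflex fields of a CM type and of its inverse agree (`M_{T⁻¹} = M_T`). -/
theorem stabilizer_inv (hcomm : ∀ a b : G, a * b = b * a) (T : Set G) :
    MulAction.stabilizer G T⁻¹ = MulAction.stabilizer G T := by
  ext g
  rw [MulAction.mem_stabilizer_iff, MulAction.mem_stabilizer_iff, smul_set_inv_of_comm hcomm,
    inv_inj]
  constructor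
  · intro h
    have h' : g • (g⁻¹ • T) = g • T := by rw [h]
    rw [smul_smul, mul_inv_cancel, one_smul] at h'
    exact h'.symm
  · intro h
    have h' : g⁻¹ • (g • T) = g⁻¹ • T := by rw [h]
    rw [smul_smul, inv_mul_cancel, one_smul] at h'
    exact h'.symm

/-- **B2.7(b), fact 3 (second half).** A coset `u • C` with `u * u ∈ C` is inversion-stable in an
abelian group (for `T₀₁₀ = u₀·Gal(F/F₀)`: `[G : Gal(F/F₀)] = 2`, so `u₀² ∈ Gal(F/F₀)`). -/
theorem inv_smul_coset (hcomm : ∀ a b : G, a * b = b * a) (C : Subgroup G) (u : G)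
    (hu : u * u ∈ C) : (u • (C : Set G))⁻¹ = u • (C : Set G) := by
  ext x
  rw [Set.mem_inv, Set.mem_smul_set_iff_inv_smul_mem, Set.mem_smul_set_iff_inv_smul_mem,
    smul_eq_mul, smul_eq_mul, SetLike.mem_coe, SetLike.mem_coe]
  have key : u⁻¹ * x⁻¹ = (u⁻¹ * x)⁻¹ * (u * u)⁻¹ := by
    rw [mul_inv_rev, mul_inv_rev, inv_inv, mul_assoc, mul_inv_cancel_left, hcomm u⁻¹ x⁻¹]
  rw [key, C.mul_mem_cancel_right (C.inv_mem hu), C.inv_mem_iff]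

/-- The index-two form of `inv_smul_coset`: every coset of a subgroup of index `2` in an abelian
group is inversion-stable. -/
theorem inv_smul_coset_of_index_two (hcomm : ∀ a b : G, a * b = b * a) (C : Subgroup G)
    (hC : C.index = 2) (u : G) : (u • (C : Set G))⁻¹ = u • (C : Set G) :=
  inv_smul_coset hcomm C u (Subgroup.mul_self_mem_of_index_two hC u)

end Group

section Galois

variable {K L : Type*} [Field K] [Field L] [Algebra K L] [FiniteDimensional K L] [IsGalois K L]

/-- **B2.7(b), fact 2.** For a finite abelian Galois extension `L/K` and an intermediate field
`F₀`, the fixed field of the stabiliser of ANY coset `u • Gal(L/F₀)` is `F₀` — Shimura's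
`K* = Fix(H*)` for the `F₀`-induced CM type (either coset, `ι₀` or `ῑ₀`, gives `F_{0,1}`). -/
theorem fixedField_stabilizer_smul_coset (hcomm : ∀ a b : (L ≃ₐ[K] L), a * b = b * a)
    (F₀ : IntermediateField K L) (u : L ≃ₐ[K] L) :
    IntermediateField.fixedField
      (MulAction.stabilizer (L ≃ₐ[K] L) (u • (F₀.fixingSubgroup : Set (L ≃ₐ[K] L)))) = F₀ := by
  rw [stabilizer_smul_coset hcomm, IsGalois.fixedField_fixingSubgroup]

omit [FiniteDimensional K L] [IsGalois K L] in
/-- The reflex field of the inverse type equals that of the type (abelian case): the fixed fields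
of the stabilisers of `T⁻¹` and `T` coincide. -/
theorem fixedField_stabilizer_inv (hcomm : ∀ a b : (L ≃ₐ[K] L), a * b = b * a)
    (T : Set (L ≃ₐ[K] L)) :
    IntermediateField.fixedField (MulAction.stabilizer (L ≃ₐ[K] L) T⁻¹) =
      IntermediateField.fixedField (MulAction.stabilizer (L ≃ₐ[K] L) T) := by
  rw [stabilizer_inv hcomm]

end Galois

end Summit.Ventures.HodgeRepro2.CosetStabilizer
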